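import Literature.MathematicalPhysics.QuantumFieldTheory.Dimock2011to13.ClusterExpansionAnalytic
import Literature.MathematicalPhysics.QuantumFieldTheory.Dimock2015.AnalyticLipschitz

/-!
# Dimock, *The renormalization group according to Balaban* II, §3.14 `\subsection{cluster expansion}` — LEMMA 3.18
# `\label{cluster}` (input (keykey), output rate (key)), LEMMAS 3.19 `\label{thirdcl}` ∕ 3.20 `\label{fourth}` (removal of
# boundary ∕ tiny terms by the (t,u)-interpolation), the *"local influence property"* of THEOREM F.1 and the combination
# (fifth) — ASSEMBLED on the torus around the landed THEOREM F.1 (`ClusterExpansionWithHoles`) and the tree's Cauchy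
# difference formula (`Dimock2015.AnalyticLipschitz`)

**Citation header (reproduction of PUBLISHED work; template of the Bałaban lattice Yang–Mills cell).**
J. Dimock, *The renormalization group according to Balaban II. Large fields*, J. Math. Phys. **54** (2013) 092301
(= arXiv:1212.5562v2) [Dimock2013BalabanII], §3.14 `\subsection{cluster expansion}` TeX L5436–5656: the interpolated
integral `Ξ″_{k,π⁺}(t,u)` and `H_{k,π⁺}(t,u,Y)` L5441–5452, LEMMA 3.18 `\label{cluster}` L5457–5473 with (output) L5460–5464
and (key) L5469–5471, its proof L5478–5500 with (keykey) L5493–5498, LEMMA 3.19 `\label{thirdcl}` (removal of boundary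
terms) L5507–5517 with (whale), its proof L5520–5535 with (hotdog) L5521–5525 and the contour formula L5527–5530, LEMMA 3.20
`\label{fourth}` (removal of tiny terms) L5539–5551 with (whale2), its proof L5554–5572 with (key4), (hotdog2), the Lemma
*"leading terms"* L5584–5604, the combination (fifth) L5606–5612; Appendix F THEOREM F.1 `\label{cluster3}` L6984–6997 and
the remark L7000 (*"In addition H^#(Y) only depends on H(X) for X ⊂ Y. We call this the local influence property of the
cluster expansion."*).  TeX line numbers refer to the arXiv source held by the cell
(`inputs/files/dimock/src/1212.5562/1212.5562.tex`); every quotation below was read there this session.  Dimock's papers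
are published and refereed and are the cell's TEMPLATE, not manuscripts under audit; no quantity of the Bałaban series
is touched.

**What the paper prints (verbatim).**  L5441–5452: *"we introduce some variables t,u which parametrize the contribution
of the other terms and define  Ξ″_{k,π⁺}(t,u) = ∫ dμ*_{Λ_{k+1}}(W_k) exp( Σ_Y H_{k,π⁺}(t,u,Y) )  where  H_{k,π⁺}(t,u,Y) = (
(δE_k^+)^{loc}(Y) + t R^{loc}_{k,π⁺}(Y) ) 1_{Y⊂Λ_{k+1}} + u B^{loc}_{k,π⁺}(Y) 1_{Y#Λ_{k+1}}"*.  LEMMA 3.18 (L5457–5473):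
*"For r_0 = 𝒪(1) sufficiently small and |t| ≤ r_0 L^{−3}λ_k^{−n_0} and |u| ≤ r_0L^{−3}λ^{−1/4+10ε}  Ξ″_{k,π⁺}(t,u) = exp( Σ_{Y
∩ Λ_{k+1} ≠ ∅} H^#_{k,π⁺}(t,u,Y) )  (output) … The function is analytic in t,u … and on this domain it satisfies
|H^#_{k,π⁺}(t,u,Y)| ≤ 𝒪(1) e^{−L(κ−6κ_0−6)d_{LM}(Y, mod Ω^c_{k+1})}  (key)"*; proof L5478–5500: *"Since integrand is
well-localized and the measure is ultralocal, we can use the cluster expansion with holes which can be found in appendix F,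
now with LM cubes. …  |u| |B^{loc}_{k,π⁺}(Y)| ≤ 𝒪(1) r_0 e^{−L(κ−3κ_0−3)d_{LM}(Y, mod Ω^c_{k+1})} ≤ ⅓c_0 e^{−L(κ−3κ_0−3)
d_{LM}(Y, mod Ω^c_{k+1})}   |t| |R^{loc}_{k,π⁺}(Y)| ≤ 𝒪(1) r_0 e^{−L(κ−3κ_0−3)d_{LM}(Y)} ≤ ⅓c_0 e^{−L(κ−3κ_0−3)d_{LM}(Y, mod
Ω^c_{k+1})}  and |(δE_k^+)^{loc}(Y)| satisfies the same bound for λ_k sufficiently small. Thus altogether  |H_{k,π⁺}(t,u,Y)| ≤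
c_0 e^{−L(κ−3κ_0−3)d_{LM}(Y, mod Ω^c_{k+1})}  (keykey)  This is the input for the cluster expansion. The output is the
representation (output) with a bound which implies (key)."*  LEMMA 3.19 (L5507–5535): *"Ξ″_{k,π⁺}(1,1) = exp( Σ_{Y#Λ_{k+1}}
B^#_{k,π⁺}(Y) ) Ξ_{k,π⁺}(1,0) … |B^#_{k,π⁺}(Y)| ≤ 𝒪(1) L³ λ^{1/4−10ε} e^{−L(κ−6κ_0−6)d_{LM}(Y, mod Ω^c_{k+1})}  (whale) …
Proof. We have  Ξ″(1,1) = exp( Σ_{Y∩Λ_{k+1}≠∅} (H^#(1,1,Y) − H^#(1,0,Y)) ) Ξ(1,0)  (hotdog)  so the identity holds with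
B^#_{k,π⁺}(Y) = H^#_{k,π⁺}(1,1,Y) − H^#_{k,π⁺}(1,0,Y) or  B^#_{k,π⁺}(Y) = (1/2πi) ∫_{|u| = r_0L^{−3}λ_k^{−1/4+10ε}} du/(u(u−1))
H^#_{k,π⁺}(1,u,Y)  Note that if Y ⊂ Λ_{k+1} then no boundary term B^{loc}_{k,π⁺}(Y) can contribute. This is a consequence
of the local influence property of the cluster expansion. Hence H^#(1,u,Y) is independent of u and so B^#_{k,π⁺}(Y) = 0.
… The bound (key) on H^#_{k,π⁺}(1,u,Y) for |u| = r_0L^{−3}λ_k^{−1/4+10ε} now implies that B^#_{k,π⁺}(Y) satisfies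
(whale)."*  LEMMA 3.20 (L5539–5572) is the same with `t`, radius `r_0L^{−3}λ_k^{−n_0}` and (whale2) `|R^#_{k,π⁺}(Y)| ≤
𝒪(1)L³λ_k^{n_0}e^{−L(κ−6κ_0−6)d_{LM}(Y)}`.  (fifth) L5606–5612: *"Combining the above results yields  Ξ″_{k,π⁺} = exp(
E_k^#(Λ_{k+1}) + R^#_{k,π⁺}(Λ_{k+1}) + B^#_{k,π⁺}(Λ_{k+1}) )"*.

**Why this module.**  TEMPLATE.md §4.2 row «D2 §3.14»: after `ClusterExpansionWithHoles` v1.1 (THEOREM F.1 with its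
integration step, this seat) the row's remaining BY-NAME items were *"Lemma 3.18 and the (t,u)-interpolation of §3.14"*.
The (t,u)-interpolation device — the Cauchy difference formula `f(1) − f(0) = (1/2πi)∮_{|t|=r} f(t)dt/(t(t−1))` and its
bound `‖f(1) − f(0)‖ ≤ sup_{|t|=r}‖f‖/(r−1)` — IS IN THE TREE (`Dimock2015.AnalyticLipschitz.difference_formula`,
`norm_sub_le_div_of_bound_sphere`, cell template file for D6's Lemma 25); this module instantiates it with §3.14's radii
and assembles Lemma 3.18's bookkeeping around the landed F.1, and proves the *"local influence property"* used at L5531.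

**What is reproduced here (kernel-checked, zero `sorry`).**
* Part 1 — LEMMA 3.18's INPUT (keykey): `Hinterp` (= `H_{k,π⁺}(t,u,Y)` at one polymer: `E + t·R·1_{Y⊂Λ} + u·B·1_{Y#Λ}`),
  `norm_smul_le_of_radius` (the printed step `|u||B^{loc}| ≤ 𝒪(1)r_0e^{−a} ≤ ⅓c_0e^{−a}`: `‖u‖ ≤ r₀/s`, `‖B‖ ≤ C·s·e^{−a}`,
  `3Cr₀ ≤ c₀`), **`norm_Hinterp_le`** (three pieces at `⅓c₀e^{−a}` ⟹ `‖H(t,u,Y)‖ ≤ c₀e^{−a}`).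
* Part 2 — LEMMA 3.18's OUTPUT RATE (key): `rate_key` (`L(κ−6κ₀−6) ≤ L(κ−3κ₀−3) − 3κ₀ − 3` for `L ≥ 1`, `κ₀ ≥ 0`),
  `three_kappa_le` (F.1's hypothesis `3κ₀ + 3 ≤ κ′` for `κ′ = L(κ−3κ₀−3)` when `L ≥ 1`, `κ ≥ 6κ₀ + 6`), and the
  instantiation **`sunshine_LM`** of `ClusterExpansionWithHoles.sunshine` at the rate `κ′ = L(κ−3κ₀−3)`: `‖H^#(V)‖ ≤
  C♯(d,κ₀)·H₀·e^{−L(κ−6κ₀−6)·coverLen univ V}` for every Ω-part `V` (*"The output is the representation (output) with a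
  bound which implies (key)"*).
* Part 3 — LEMMAS 3.19∕3.20, THE (t,u)-INTERPOLATION: **`sub_eq_contour`** (= `B^# = (1/2πi)∮_{|u|=ρ} du/(u(u−1))
  H^#(1,u,Y)`: the tree's `Dimock2015.difference_formula`, BY NAME), **`norm_sub_le_two_mul_div`** (`ρ ≥ 2`, `‖f‖ ≤ M` on
  `|t| = ρ` ⟹ `‖f(1) − f(0)‖ ≤ 2M/ρ`, from the tree's `M/(ρ−1)`), `two_mul_div_radius` (`2M/ρ = (2/r₀)L³λ^p·M` at `ρ =
  r₀/(L³λ^p)`), **`whale`** (`‖f(1) − f(0)‖ ≤ (2/r₀)·L³·λ^p·M` — (whale) with `p = ¼ − 10ε`, `M = 𝒪(1)e^{−L(κ−6κ₀−6)d}`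
  from (key); (whale2) with `p = n₀`).
* Part 4 — THE LOCAL INFLUENCE PROPERTY OF THEOREM F.1 (L7000), PROVED for the App. B kernel's `H^#`:
  **`Hsharp_congr_local`** (`MayerExpansion.Hsharp supp Pol w V` only depends on the activities `w(V′)` of the polymers
  `V′ ⊆ V` of the regrouped gas — tree `LatticeModels.truncatedWeight_congr`), whence **`Hsharp_sub_eq_zero_of_local`** (two
  activity families agreeing on the parts inside `V` have the same `H^#(V)`: *"if Y ⊂ Λ_{k+1} then no boundary term can
  contribute … H^#(1,u,Y) is independent of u and so B^#(Y) = 0"*, L5531–5533).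
* Part 5 — THE COMBINATION: `hotdog` (`Ξ(1,1) = exp(Σ_Y (H^#(1,1,Y) − H^#(1,0,Y)))·Ξ(1,0)` from `Ξ(t,u) = exp(Σ_Y
  H^#(t,u,Y))`), `fifth` (`Ξ(1,1) = e^{B^#}Ξ(1,0)`, `Ξ(1,0) = e^{R^#}Ξ(0,0)`, `Ξ(0,0) = e^{E^#}` ⟹ `Ξ(1,1) = exp(E^# + R^# +
  B^#)`).
* Part 6 (v1.1) — (key) AND *"B^#(Y) = 0 inside Λ_{k+1}"* IN THE PRINTED INDEXING (the regrouped gas indexed by the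
  Ω-connected UNIONS `Y` of the sibling `ClusterExpansionByUnions`, decay in the printed length `d_M(Y, mod Ω^c)` =
  `torusTreeLenMod Y Θ`): **`sunshineY_LM`** (`‖H^#(Y)‖ ≤ C♯(d,κ₀)·H₀·e^{−L(κ−6κ₀−6)·d_M(Y, mod Θ)}` for every `Y ∈ cunions Θ
  Pol`, from `ClusterExpansionByUnions.sunshineY` at the input rate `κ′ = L(κ−3κ₀−3)` and `rate_key`), `sunshineY_LM_of_H` (the
  same for the activities `e^{H(X)} − 1`), **`HsharpL_sub_eq_zero_of_local`** (two activity families agreeing on the unions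
  `Y′ ⊆ Y` of the volume give `H^#_{u=1}(Y) − H^#_{u=0}(Y) = 0` — `ClusterExpansionByUnions.HsharpL_congr_local`).
* Part 7 (v1.2) — (whale) FOR THE KERNEL's `H^#(1,u,Y)` WITH THE ANALYTICITY HYPOTHESIS DISCHARGED (reading (iii) closed
  for the kernel's `H^#` by the sibling `ClusterExpansionAnalytic`, which PROVES *"The function is analytic in t,u"* for
  the Kotecký–Preiss form): `aInterp` (the interpolated activities `e^{H(X) + u·B(X)} − 1`), `HsharpInterp` (`u ↦
  H^#(1,u,Y)`), **`whale_kernel`** (`2 ≤ ρ < ρ′`, the gas of unions Kotecký–Preiss for every `|u| < ρ′`, `‖H^#(1,u,Y)‖ ≤ M` on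
  `|u| = ρ` ⟹ `‖H^#(1,1,Y) − H^#(1,0,Y)‖ ≤ 2M/ρ`), **`whale_kernel_radius`** (the same at `ρ = r₀/(L³λ^p)`: `≤
  (2/r₀)·L³·λ^p·M`, (whale)∕(whale2) verbatim up to the constant), `sub_eq_contour_kernel` (the contour formula L5527–5530
  for the kernel's `H^#`, analyticity discharged).
* Part 8 (v1.3) — (whale) FOR THE KERNEL's `H^#` FROM (keykey) ON THE DISC, on the torus: `kp_of_keykey` ((keykey) at one `u`
  ⟹ the interpolated gas of unions is a Kotecký–Preiss volume, via `weight_le_of_mem`, `norm_KY_le_of_mem_cunions`,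
  `isKPVolumeY`), **`whale_from_keykey`** (`‖H(X) + u·B(X)‖ ≤ c₀e^{−L(κ−3κ₀−3)d_M(X, mod Θ)}` for `|u| ≤ ρ′`, the F.1 regime
  `max(κ₁(d), 4·2^d) ≤ κ₀`, `κ ≥ 6κ₀ + 6`, `L ≥ 1`, `0 ≤ c₀ ≤ log 2`, `2e·K₁(d)²·κ₀·e^{L(κ−3κ₀−3)}·c₀ ≤ 1`, and `2 ≤ ρ < ρ′` ⟹
  `‖H^#(1,1,Y) − H^#(1,0,Y)‖ ≤ (2/ρ)·C♯(d,κ₀)·c₀·e^{−L(κ−6κ₀−6)·d_M(Y, mod Θ)}` for every Ω-connected union `Y` — Lemma 3.19's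
  (whale) with the printed decay, ALL of analyticity, (output) and (key) discharged; only (keykey) and the regime remain).
* Part 9 (v1.4) — THE HOLE-FREE CASE (LEMMA 3.20's setting, L5554–5555: *"Now we are back to the standard cluster expansion
  with no holes and all polymers contained in Λ_{k+1}"*): **`whale_from_keykey_noHoles`** (`Θ = ∅`, non-empty face-connected
  polymers, decay in part I's `d_M(Y)` — `whale_from_keykey` with `pol_of_noHoles`, `torusTreeLenMod_empty`; read with
  `(H, B, u) := ((δE_k^+)^{loc}, R^{loc}, t)` it is (whale2)'s shape `‖R^#(Y)‖ ≤ (2/ρ)·C♯·c₀·e^{−L(κ−6κ₀−6)d_M(Y)}`).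
* Part 10 (v1.5) — (whale) AS PRINTED, CONSTANTS IDENTIFIED: **`whale_printed`** (`whale_from_keykey` at the printed radius `ρ =
  r₀/(L³λ^p)`, `p = ¼ − 10ε`: `‖B^#(Y)‖ ≤ (2/r₀)·L³·λ^p·C♯(d,κ₀)·c₀·e^{−L(κ−6κ₀−6)·d_M(Y, mod Θ)}` — the print's `𝒪(1)L³λ_k^{1/4−10ε}
  e^{−L(κ−6κ_0−6)d_{LM}(Y, mod Ω^c_{k+1})}` with `𝒪(1) = (2/r₀)·C♯(d,κ₀)·c₀` explicit; `two_mul_div_radius`), **`whale_printed_noHoles`**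
  (the same at `Θ = ∅`, (whale2) as printed with `p = n₀`).

**Readings ∕ divergences (declared).**  (i) Parts 1, 2, 5 are the printed bookkeeping as real∕complex inequalities and
identities over abstract numbers; the objects `(δE_k^+)^{loc}`, `R^{loc}`, `B^{loc}` and their bounds (Lemmas 3.15–3.17)
are NOT constructed — they enter as the hypotheses `hE`, `hR`, `hB`.  (ii) Part 2's `sunshine_LM` is F.1 on the cell's
torus carrier *"now with LM cubes"* read as: the same carrier (cubes are cubes), the rate `κ′ = L(κ−3κ₀−3)` in place of
`κ`; `d_{LM}` is the carrier's `coverLen univ` as in `ClusterExpansionWithHoles` (reading (ii) there).  (iii) Part 3 takes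
the ANALYTICITY of `u ↦ H^#(1,u,Y)` on the closed disc as a hypothesis (`DifferentiableOn ℂ f (closedBall 0 ρ)`): F.1's
analyticity statement (*"The function is analytic in t,u"*, L5466) is not typed (the App. B kernel's `H^#` is built from
the Kotecký–Preiss logarithm; its analytic dependence on parameters of the activities is not in the tree).  [v1.2: this
hypothesis is DISCHARGED for the kernel's `H^#` by the sibling `ClusterExpansionAnalytic` — Part 7 `whale_kernel`; Part 3
keeps the abstract `f`.]  The bound is
the tree's `M/(ρ−1)`, weakened to `2M/ρ` for `ρ ≥ 2` (*"λ_k sufficiently small"* makes the printed radii large); the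
print's `𝒪(1)L³λ^{1/4−10ε}` is `(2/r₀)·L³·λ^{1/4−10ε}·𝒪(1)`.  (iv) Part 4 is stated for the App. B kernel's `H^#` over any
polymer∕support type; the printed use (no boundary term inside `Λ_{k+1}`) is the instance where the `u`-dependent
activities vanish on the Ω-parts inside `V`.

**What is NOT claimed.**  The construction of `Ξ″_{k,π⁺}(t,u)` from §3.13, Lemmas 3.15–3.17 (the localized pieces and
their bounds), the analyticity of `H^#` in `(t,u)`, the Lemma *"leading terms"* (identification with part I's global
small-field `E^#_k`), anything of B1–B16 (the row's Bałaban side — B13 §2, B16 §1 (1.90)–(1.98) — untouched).  NOT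
summit progress; NOT a statement about any Bałaban paper; NOT continuum; NOT Clay.  NEW leaf; imports
`…Dimock2011to13.ClusterExpansionAnalytic` (this lineage; v1 imported `…ClusterExpansionWithHoles`, v1.1
`…ClusterExpansionByUnions` — the same chain) and `…Dimock2015.AnalyticLipschitz` (cell template file, Mathlib-only); no Summits import; no cycle; modifies nothing; no named
fact (net debt 0).  Unit `b2b-balaban-template` gen 37 round 3 (journal CLAIM D2-SECT314-INTERPOLATION-KERNEL); cell records
TEMPLATE.md §4.2 row «D2 §3.14», §15.2; GAPS C-tmpl37-3.

**Version.**  v1 (gen 37 round 3, p220197): Parts 1–5.  v1.1 (gen 38 round 1, unit `b2b-balaban-template`, 2026-08-20): the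
import moved one module down the same chain (`ClusterExpansionByUnions`, which imports `ClusterExpansionWithHoles`) and
Part 6 appended — (key) and the *"B^# = 0 inside Λ_{k+1}"* step in the PRINTED indexing (`sunshineY_LM`, `sunshineY_LM_of_H`,
`HsharpL_sub_eq_zero_of_local`); every v1 declaration unchanged (journal CLAIM D2-KEY-PRINTED-INDEXING-KERNEL; GAPS C-tmpl38-1).
v1.2 (gen 38 round 4, same seat): the import moved to the sibling `ClusterExpansionAnalytic` (which imports
`ClusterExpansionByUnions`) and Part 7 appended — (whale) for the kernel's `H^#(1,u,Y)` with the analyticity hypothesis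
DISCHARGED (`aInterp`, `HsharpInterp`, `whale_kernel`, `whale_kernel_radius`, `sub_eq_contour_kernel`); every v1∕v1.1
declaration unchanged (journal CLAIM D2-WHALE-KERNEL; GAPS C-tmpl38-5).  v1.3 (gen 38 round 5, same seat): Part 8
appended — (whale) for the kernel's `H^#` from (keykey) on the disc (`kp_of_keykey`, `whale_from_keykey`); every earlier
declaration unchanged (journal CLAIM D2-WHALE-FROM-KEYKEY; GAPS C-tmpl38-6).  v1.4 (gen 38 round 6, same seat): Part 9
appended — the hole-free case `whale_from_keykey_noHoles` ((whale2)'s setting); every earlier declaration unchanged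
(journal CLAIM D2-WHALE2-NOHOLES; GAPS C-tmpl38-7).  v1.5 (gen 38 round 7, same seat): Part 10 appended — (whale)∕(whale2) AS
PRINTED at the radius `r₀/(L³λ^p)` (`whale_printed`, `whale_printed_noHoles`); every earlier declaration unchanged (journal
CLAIM D2-WHALE-PRINTED; GAPS C-tmpl38-8).
-/

noncomputable section

open Real Finset Metric Set
open Literature.MathematicalPhysics.QuantumFieldTheory.Balaban1983to89
open Literature.MathematicalPhysics.QuantumFieldTheory.Balaban1983to89.TreeLengthTorus

namespace Literature.MathematicalPhysics.QuantumFieldTheory.Dimock2011to13.InterpolationRemoval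

open Literature.MathematicalPhysics.QuantumFieldTheory.Dimock2011to13.ThreeSorted
open Literature.MathematicalPhysics.QuantumFieldTheory.Dimock2011to13.HoleSummability
open Literature.MathematicalPhysics.QuantumFieldTheory.Dimock2011to13.MayerExpansion
open Literature.MathematicalPhysics.QuantumFieldTheory.Dimock2011to13.ClusterExpansionWithHoles
open Literature.MathematicalPhysics.QuantumFieldTheory.Dimock2015 (difference_formula norm_sub_le_div_of_bound_sphere)
open Literature.Probability.LatticeModels (truncatedWeight truncatedWeight_congr)

/-! ## Part 1. LEMMA 3.18's input (keykey): three localized pieces at `⅓c₀` each -/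

/-- `H_{k,π⁺}(t,u,Y)` AT ONE POLYMER (L5446–5451): `E + t·R·1_{Y⊂Λ_{k+1}} + u·B·1_{Y#Λ_{k+1}}` with `E = (δE_k^+)^{loc}(Y)`,
`R = R^{loc}_{k,π⁺}(Y)`, `B = B^{loc}_{k,π⁺}(Y)` (complex numbers at fixed fields) and the two indicators.
[cite: Dimock2013BalabanII, §3.14 (arXiv:1212.5562v2 TeX L5441–5452)] -/
def Hinterp (E R B : ℂ) (inΛ crossΛ : Prop) [Decidable inΛ] [Decidable crossΛ] (t u : ℂ) : ℂ :=
  (E + if inΛ then t * R else 0) + if crossΛ then u * B else 0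

/-- THE RADIUS STEP of (keykey) (L5488–5492: *"|u| |B^{loc}_{k,π⁺}(Y)| ≤ 𝒪(1) r_0 e^{−L(κ−3κ_0−3)d} ≤ ⅓c_0 e^{−L(κ−3κ_0−3)d}"*):
if `‖u‖ ≤ r₀/s` (the radius `r_0L^{−3}λ^{−1/4+10ε}` = `r₀/s` with `s = L³λ^{1/4−10ε}`), `‖B‖ ≤ C·s·w` (the bound on the
localized piece) and `3Cr₀ ≤ c₀` (*"r_0 = 𝒪(1) sufficiently small"*), then `‖u·B‖ ≤ ⅓c₀·w`.
[cite: Dimock2013BalabanII, §3.14 Lemma 3.18 proof (arXiv:1212.5562v2 TeX L5486–5498)] -/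
theorem norm_smul_le_of_radius {u B : ℂ} {r₀ s C c₀ w : ℝ} (hs : 0 < s) (hr₀ : 0 ≤ r₀) (hw : 0 ≤ w)
    (hu : ‖u‖ ≤ r₀ / s) (hB : ‖B‖ ≤ C * s * w) (hsmall : 3 * C * r₀ ≤ c₀) : ‖u * B‖ ≤ c₀ / 3 * w := by
  rw [norm_mul]
  calc ‖u‖ * ‖B‖ ≤ (r₀ / s) * (C * s * w) := mul_le_mul hu hB (norm_nonneg _) (div_nonneg hr₀ hs.le)
    _ = C * r₀ * w := by field_simp
    _ ≤ c₀ / 3 * w := by nlinarith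

/-- **(keykey)** — [Dimock2013BalabanII] §3.14, verbatim (L5493–5498): *"Thus altogether  |H_{k,π⁺}(t,u,Y)| ≤ c_0 e^{−L(κ−3κ_0−3)
d_{LM}(Y, mod Ω^c_{k+1})}  This is the input for the cluster expansion."* — from the three pieces at `⅓c₀·w` each (`w` the
decay factor): `‖E‖ ≤ ⅓c₀w`, `‖tR‖ ≤ ⅓c₀w`, `‖uB‖ ≤ ⅓c₀w` ⟹ `‖H(t,u,Y)‖ ≤ c₀w`, whatever the indicators.
[cite: Dimock2013BalabanII, §3.14 Lemma 3.18 proof eq. (keykey) (arXiv:1212.5562v2 TeX L5486–5498)] -/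
theorem norm_Hinterp_le {E R B t u : ℂ} {c₀ w : ℝ} (hc₀ : 0 ≤ c₀) (hw : 0 ≤ w) (hE : ‖E‖ ≤ c₀ / 3 * w)
    (hR : ‖t * R‖ ≤ c₀ / 3 * w) (hB : ‖u * B‖ ≤ c₀ / 3 * w) (inΛ crossΛ : Prop) [Decidable inΛ] [Decidable crossΛ] :
    ‖Hinterp E R B inΛ crossΛ t u‖ ≤ c₀ * w := by
  unfold Hinterp
  have h1 : ‖(if inΛ then t * R else 0 : ℂ)‖ ≤ c₀ / 3 * w := by
    split_ifs
    · exact hR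
    · rw [norm_zero]; positivity
  have h2 : ‖(if crossΛ then u * B else 0 : ℂ)‖ ≤ c₀ / 3 * w := by
    split_ifs
    · exact hB
    · rw [norm_zero]; positivity
  calc ‖(E + if inΛ then t * R else 0) + if crossΛ then u * B else 0‖
      ≤ ‖E + if inΛ then t * R else 0‖ + ‖(if crossΛ then u * B else 0 : ℂ)‖ := norm_add_le _ _
    _ ≤ (‖E‖ + ‖(if inΛ then t * R else 0 : ℂ)‖) + ‖(if crossΛ then u * B else 0 : ℂ)‖ := by
        gcongr
        exact norm_add_le _ _
    _ ≤ c₀ / 3 * w + c₀ / 3 * w + c₀ / 3 * w := by linarith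
    _ = c₀ * w := by ring

/-! ## Part 2. LEMMA 3.18's output rate (key), instantiated on THEOREM F.1 -/

/-- THE RATE ARITHMETIC OF (key): applying F.1 (loss `3κ₀ + 3`) at the input rate `κ′ = L(κ−3κ₀−3)` of (keykey) leaves at
least the printed output rate `L(κ−6κ₀−6)` when `L ≥ 1`, `κ₀ ≥ 0`: `L(κ−6κ₀−6) ≤ L(κ−3κ₀−3) − 3κ₀ − 3`.
[cite: Dimock2013BalabanII, §3.14 Lemma 3.18 eq. (key) (arXiv:1212.5562v2 TeX L5466–5471, L5499–5500)] -/
theorem rate_key {L κ κ₀ : ℝ} (hL : 1 ≤ L) (hκ₀ : 0 ≤ κ₀) :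
    L * (κ - 6 * κ₀ - 6) ≤ L * (κ - 3 * κ₀ - 3) - 3 * κ₀ - 3 := by
  nlinarith

/-- F.1's rate hypothesis `3κ₀ + 3 ≤ κ′` at `κ′ = L(κ−3κ₀−3)` holds as soon as `L ≥ 1` and `κ ≥ 6κ₀ + 6` (`κ₀ ≥ 0`).
[cite: Dimock2013BalabanII, §3.14 Lemma 3.18 (arXiv:1212.5562v2 TeX L5457–5473)] -/
theorem three_kappa_le {L κ κ₀ : ℝ} (hL : 1 ≤ L) (hκ₀ : 0 ≤ κ₀) (hκ : 6 * κ₀ + 6 ≤ κ) :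
    3 * κ₀ + 3 ≤ L * (κ - 3 * κ₀ - 3) := by
  nlinarith

section Torus

variable {d N : ℕ} [NeZero N]

/-- **LEMMA 3.18's OUTPUT (key) FROM THEOREM F.1** (*"The output is the representation (output) with a bound which implies
(key)"*, L5499–5500): `ClusterExpansionWithHoles.sunshine` at the input rate `κ′ = L(κ−3κ₀−3)` of (keykey) gives, for every
Ω-part `V` of the regrouped gas, `‖H^#(V)‖ ≤ C♯(d,κ₀)·H₀·e^{−L(κ−6κ₀−6)·coverLen univ V}` — under the cell's form of the
hypotheses: polymers with holes `Pol`, activities `‖a X‖ ≤ 2H₀e^{−κ′ d_M(X, mod Θ)}`, `max(κ₁(d), 4·2^d) ≤ κ₀`, `L ≥ 1`, `κ ≥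
6κ₀ + 6`, `0 ≤ H₀`, `2e·K₁(d)²·κ₀·e^{κ′}·H₀ ≤ 1` (`H₀` = the print's `c_0` of (keykey)).
[cite: Dimock2013BalabanII, §3.14 Lemma 3.18 eqs. (output), (key) (arXiv:1212.5562v2 TeX L5457–5500)] -/
theorem sunshine_LM (Θ : Finset (TPt d N)) {Pol : Finset (Finset (TPt d N))}
    (hPol : ∀ X ∈ Pol, X.Nonempty ∧ TFaceConnected X ∧ DMod Θ X ∧ (X \ Θ).Nonempty)
    {a : Finset (TPt d N) → ℂ} {κ κ₀ H₀ L : ℝ} (hκ₁ : kappa₁ d ≤ κ₀) (hκv : 4 * 2 ^ d ≤ κ₀) (hL : 1 ≤ L)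
    (hκ : 6 * κ₀ + 6 ≤ κ) (hH₀ : 0 ≤ H₀)
    (ha : ∀ X ∈ Pol, ‖a X‖ ≤ 2 * H₀ * Real.exp (-(L * (κ - 3 * κ₀ - 3)) * torusTreeLenMod X Θ))
    (hsmall : 2 * Real.exp 1 * K₁ d ^ 2 * κ₀ * Real.exp (L * (κ - 3 * κ₀ - 3)) * H₀ ≤ 1)
    {V : Finset (TPt d N)} (hV : V ∈ unions (fun X : Finset (TPt d N) => X \ Θ) Pol) :
    ‖Hsharp (fun X : Finset (TPt d N) => X \ Θ) Pol
        (K (fun X : Finset (TPt d N) => X \ Θ) Pol (fun T => ∏ X ∈ T, a X)) V‖ ≤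
      Csharp d κ₀ * H₀ * Real.exp (-(L * (κ - 6 * κ₀ - 6)) * coverLen Finset.univ V) := by
  have hκ₀ : 0 ≤ κ₀ := le_trans (by positivity) hκv
  have h := sunshine Θ hPol hκ₁ hκv (three_kappa_le hL hκ₀ hκ) hH₀ ha hsmall hV
  refine h.trans (mul_le_mul_of_nonneg_left (Real.exp_le_exp.2 ?_) ?_)
  · have hℓ := coverLen_nonneg (Finset.univ : Finset (TPt d N)) V
    have hr := rate_key (κ := κ) hL hκ₀
    nlinarith
  · have := K₁_pos d
    unfold Csharp
    positivity

end Torus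

/-! ## Part 3. LEMMAS 3.19 ∕ 3.20: removal of boundary ∕ tiny terms by the (t,u)-interpolation -/

section Removal

variable {F : Type*} [NormedAddCommGroup F] [NormedSpace ℂ F] [CompleteSpace F]

/-- **THE CONTOUR FORMULA OF LEMMA 3.19** (L5527–5530: *"B^#_{k,π⁺}(Y) = H^#(1,1,Y) − H^#(1,0,Y) = (1/2πi) ∫_{|u| =
r_0L^{−3}λ_k^{−1/4+10ε}} du/(u(u−1)) H^#_{k,π⁺}(1,u,Y)"*; L5566–5569 for `t`), for any `f` complex differentiable on the
closed disc of radius `ρ > 1` — the tree's `Dimock2015.difference_formula`, BY NAME.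
[cite: Dimock2013BalabanII, §3.14 Lemma 3.19 proof (arXiv:1212.5562v2 TeX L5520–5530)] -/
theorem sub_eq_contour {f : ℂ → F} {ρ : ℝ} (hρ : 1 < ρ) (hf : DifferentiableOn ℂ f (closedBall 0 ρ)) :
    f 1 - f 0 = (2 * Real.pi * Complex.I : ℂ)⁻¹ • ∮ t in C(0, ρ), (t * (t - 1))⁻¹ • f t :=
  difference_formula hρ hf

/-- THE BOUND DRAWN FROM THE CONTOUR FORMULA (L5534–5535: *"The bound (key) on H^#(1,u,Y) for |u| = r_0L^{−3}λ_k^{−1/4+10ε}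
now implies that B^#_{k,π⁺}(Y) satisfies (whale)"*): if `‖f‖ ≤ M` on the circle `|t| = ρ` with `ρ ≥ 2`, then `‖f(1) −
f(0)‖ ≤ 2M/ρ` (the tree's `M/(ρ−1)`, `Dimock2015.norm_sub_le_div_of_bound_sphere`, and `ρ − 1 ≥ ρ/2`).
[cite: Dimock2013BalabanII, §3.14 Lemma 3.19 proof (arXiv:1212.5562v2 TeX L5520–5535)] -/
theorem norm_sub_le_two_mul_div {f : ℂ → F} {ρ M : ℝ} (hρ : 2 ≤ ρ) (hf : DifferentiableOn ℂ f (closedBall 0 ρ))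
    (hM : ∀ t ∈ sphere (0 : ℂ) ρ, ‖f t‖ ≤ M) : ‖f 1 - f 0‖ ≤ 2 * M / ρ := by
  have hρ1 : 1 < ρ := by linarith
  have hM0 : 0 ≤ M := by
    have hmem : ((ρ : ℝ) : ℂ) ∈ sphere (0 : ℂ) ρ := by
      rw [mem_sphere, dist_zero_right, Complex.norm_real, Real.norm_eq_abs, abs_of_pos (by linarith)]
    exact (norm_nonneg _).trans (hM _ hmem)
  refine (norm_sub_le_div_of_bound_sphere hρ1 hf hM).trans ?_
  rw [div_le_div_iff₀ (by linarith) (by linarith)]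
  nlinarith

/-- THE RADIUS ARITHMETIC: at `ρ = r₀/(L³λ^p)` (the printed radii `r_0L^{−3}λ^{−1/4+10ε}`, `r_0L^{−3}λ_k^{−n_0}`), `2M/ρ =
(2/r₀)·L³·λ^p·M`. [cite: Dimock2013BalabanII, §3.14 Lemmas 3.19–3.20 (arXiv:1212.5562v2 TeX L5507–5572)] -/
theorem two_mul_div_radius {r₀ L lam p M : ℝ} (hr₀ : 0 < r₀) (hL : 0 < L) (hlam : 0 < lam) :
    2 * M / (r₀ / (L ^ 3 * lam ^ p)) = 2 / r₀ * L ^ 3 * lam ^ p * M := by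
  have h1 : (0 : ℝ) < L ^ 3 * lam ^ p := mul_pos (pow_pos hL 3) (Real.rpow_pos_of_pos hlam p)
  field_simp

/-- **(whale) ∕ (whale2)** — [Dimock2013BalabanII] Lemma 3.19, verbatim (L5514–5516): *"|B^#_{k,π⁺}(Y)| ≤ 𝒪(1) L³ λ^{1/4−10ε}
e^{−L(κ−6κ_0−6)d_{LM}(Y, mod Ω^c_{k+1})}"* (and Lemma 3.20's (whale2) with `λ_k^{n_0}`): for `f` (= `u ↦ H^#(1,u,Y)`)
complex differentiable on the closed disc of radius `ρ = r₀/(L³λ^p) ≥ 2` and bounded there on the circle by `M` (= the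
(key) bound `𝒪(1)e^{−L(κ−6κ₀−6)d}`), `‖f(1) − f(0)‖ ≤ (2/r₀)·L³·λ^p·M`.  READING (iii): analyticity is a hypothesis;
`𝒪(1) = 2·𝒪(1)_{(key)}/r₀`. [cite: Dimock2013BalabanII, §3.14 Lemma 3.19 eq. (whale), Lemma 3.20 eq. (whale2) (arXiv:1212.5562v2 TeX L5507–5572)] -/
theorem whale {f : ℂ → F} {r₀ L lam p M : ℝ} (hr₀ : 0 < r₀) (hL : 0 < L) (hlam : 0 < lam)
    (hρ : 2 ≤ r₀ / (L ^ 3 * lam ^ p)) (hf : DifferentiableOn ℂ f (closedBall 0 (r₀ / (L ^ 3 * lam ^ p))))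
    (hM : ∀ t ∈ sphere (0 : ℂ) (r₀ / (L ^ 3 * lam ^ p)), ‖f t‖ ≤ M) :
    ‖f 1 - f 0‖ ≤ 2 / r₀ * L ^ 3 * lam ^ p * M := by
  rw [← two_mul_div_radius hr₀ hL hlam]
  exact norm_sub_le_two_mul_div hρ hf hM

/-- When is the printed radius large (*"λ_k sufficiently small"*)?  `ρ = r₀/(L³λ^p) ≥ 2` iff `2L³λ^p ≤ r₀`.
[cite: Dimock2013BalabanII, §3.14 Lemma 3.18 (arXiv:1212.5562v2 TeX L5457–5459)] -/
theorem two_le_radius_iff {r₀ L lam p : ℝ} (hL : 0 < L) (hlam : 0 < lam) :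
    2 ≤ r₀ / (L ^ 3 * lam ^ p) ↔ 2 * (L ^ 3 * lam ^ p) ≤ r₀ := by
  have h1 : (0 : ℝ) < L ^ 3 * lam ^ p := mul_pos (pow_pos hL 3) (Real.rpow_pos_of_pos hlam p)
  rw [le_div_iff₀ h1]

end Removal

/-! ## Part 4. The local influence property of THEOREM F.1 (L7000), used at L5531–5533 -/

section LocalInfluence

variable {P C : Type*} [DecidableEq C]

/-- **THE LOCAL INFLUENCE PROPERTY** — [Dimock2013BalabanII] App. F, verbatim (L7000): *"In addition H^#(Y) only depends on H(X)
for X ⊂ Y. We call this the local influence property of the cluster expansion."* — for the App. B kernel's `H^#`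
(`MayerExpansion.Hsharp`, the Kotecký–Preiss form): `H^#(V)` is a sum of truncated functionals `Φ^T(𝒞)` over sub-families
`𝒞` of the regrouped gas with `∪𝒞 = V`, and `Φ^T(𝒞)` only involves the activities of the members of `𝒞` (tree
`LatticeModels.truncatedWeight_congr`); hence two activity families agreeing on the polymers `V′ ⊆ V` of the gas give the
same `H^#(V)`. [cite: Dimock2013BalabanII, App. F Theorem cluster3, remark (arXiv:1212.5562v2 TeX L7000)] -/
theorem Hsharp_congr_local {supp : P → Finset C} {Pol : Finset P} {w w' : Finset C → ℂ} {V : Finset C}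
    (h : ∀ V' ∈ unions supp Pol, V' ⊆ V → w V' = w' V') : Hsharp supp Pol w V = Hsharp supp Pol w' V := by
  unfold Hsharp
  refine Finset.sum_congr rfl fun 𝒞 h𝒞 => ?_
  obtain ⟨h𝒞L, hU⟩ := Finset.mem_filter.1 h𝒞
  rw [Finset.mem_powerset] at h𝒞L
  refine truncatedWeight_congr fun V' hV' => h V' (h𝒞L hV') ?_
  rw [← hU]
  exact Finset.subset_biUnion_of_mem id hV'

/-- *"if Y ⊂ Λ_{k+1} then no boundary term B^{loc}_{k,π⁺}(Y) can contribute. This is a consequence of the local influence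
property of the cluster expansion. Hence H^#(1,u,Y) is independent of u and so B^#_{k,π⁺}(Y) = 0"* (L5531–5533): if the
`u = 1` and `u = 0` activities agree on the polymers of the gas inside `V`, then `B^#(V) = H^#_{u=1}(V) − H^#_{u=0}(V) = 0`.
[cite: Dimock2013BalabanII, §3.14 Lemma 3.19 proof (arXiv:1212.5562v2 TeX L5531–5533)] -/
theorem Hsharp_sub_eq_zero_of_local {supp : P → Finset C} {Pol : Finset P} {w₁ w₀ : Finset C → ℂ} {V : Finset C}
    (h : ∀ V' ∈ unions supp Pol, V' ⊆ V → w₁ V' = w₀ V') :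
    Hsharp supp Pol w₁ V - Hsharp supp Pol w₀ V = 0 := by
  rw [Hsharp_congr_local h, sub_self]

end LocalInfluence

/-! ## Part 5. The combination (hotdog) ∕ (fifth) -/

/-- **(hotdog)** (L5521–5525): from the representation (output) `Ξ(t,u) = exp(Σ_Y H^#(t,u,Y))`,
`Ξ(1,1) = exp( Σ_Y (H^#(1,1,Y) − H^#(1,0,Y)) )·Ξ(1,0)`. [cite: Dimock2013BalabanII, §3.14 Lemma 3.19 proof eq. (hotdog) (arXiv:1212.5562v2 TeX L5520–5526)] -/
theorem hotdog {ι : Type*} (s : Finset ι) (H : ℂ → ℂ → ι → ℂ) (Ξ : ℂ → ℂ → ℂ)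
    (hΞ : ∀ t u, Ξ t u = Complex.exp (∑ Y ∈ s, H t u Y)) :
    Ξ 1 1 = Complex.exp (∑ Y ∈ s, (H 1 1 Y - H 1 0 Y)) * Ξ 1 0 := by
  rw [hΞ 1 1, hΞ 1 0, ← Complex.exp_add, Finset.sum_sub_distrib, sub_add_cancel]

/-- **(fifth)** — [Dimock2013BalabanII] §3.14, verbatim (L5606–5612): *"Combining the above results yields  Ξ″_{k,π⁺} = exp(
E_k^#(Λ_{k+1}) + R^#_{k,π⁺}(Λ_{k+1}) + B^#_{k,π⁺}(Λ_{k+1}) )"* — from Lemma 3.19 (`Ξ(1,1) = e^{B^#}Ξ(1,0)`), Lemma 3.20 (`Ξ(1,0) =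
e^{R^#}Ξ(0,0)`) and the leading-terms Lemma (`Ξ(0,0) = e^{E^#}`). [cite: Dimock2013BalabanII, §3.14 eq. (fifth) (arXiv:1212.5562v2 TeX L5606–5612)] -/
theorem fifth {Ξ₁₁ Ξ₁₀ Ξ₀₀ Es Rs Bs : ℂ} (h₁ : Ξ₁₁ = Complex.exp Bs * Ξ₁₀) (h₂ : Ξ₁₀ = Complex.exp Rs * Ξ₀₀)
    (h₃ : Ξ₀₀ = Complex.exp Es) : Ξ₁₁ = Complex.exp (Es + Rs + Bs) := by
  rw [h₁, h₂, h₃, ← Complex.exp_add, ← Complex.exp_add]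
  ring_nf

/-! ## Part 6 (v1.1). (key) and «B^# = 0 inside Λ_{k+1}» in the PRINTED indexing (unions `Y`, decay `d_M(Y, mod Ω^c)`) -/

section PrintedIndexing

open Literature.MathematicalPhysics.QuantumFieldTheory.Dimock2011to13.ClusterExpansionByUnions

variable {d N : ℕ} [NeZero N]

/-- **LEMMA 3.18's OUTPUT (key) IN THE PRINTED INDEXING** (L5469–5471: *"|H^#_{k,π⁺}(t,u,Y)| ≤ 𝒪(1) e^{−L(κ−6κ_0−6)d_{LM}(Y,
mod Ω^c_{k+1})}"*, with L5499–5500 *"The output is the representation (output) with a bound which implies (key)"*): THEOREM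
F.1 in the printed indexing (`ClusterExpansionByUnions.sunshineY`: the regrouped gas indexed by the Ω-connected unions `Y`,
decay in the printed length `d_M(Y, mod Θ)`) at the input rate `κ′ = L(κ−3κ₀−3)` of (keykey) gives, for every `Y ∈ cunions Θ
Pol`, `‖H^#(Y)‖ ≤ C♯(d,κ₀)·H₀·e^{−L(κ−6κ₀−6)·d_M(Y, mod Θ)}` — hypotheses as in `sunshine_LM` (`H₀` = the print's `c_0`).
[cite: Dimock2013BalabanII, §3.14 Lemma 3.18 eqs. (output), (key) (arXiv:1212.5562v2 TeX L5457–5500)] -/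
theorem sunshineY_LM (Θ : Finset (TPt d N)) {Pol : Finset (Finset (TPt d N))}
    (hPol : ∀ X ∈ Pol, X.Nonempty ∧ TFaceConnected X ∧ DMod Θ X ∧ (X \ Θ).Nonempty)
    {a : Finset (TPt d N) → ℂ} {κ κ₀ H₀ L : ℝ} (hκ₁ : kappa₁ d ≤ κ₀) (hκv : 4 * 2 ^ d ≤ κ₀) (hL : 1 ≤ L)
    (hκ : 6 * κ₀ + 6 ≤ κ) (hH₀ : 0 ≤ H₀)
    (ha : ∀ X ∈ Pol, ‖a X‖ ≤ 2 * H₀ * Real.exp (-(L * (κ - 3 * κ₀ - 3)) * torusTreeLenMod X Θ))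
    (hsmall : 2 * Real.exp 1 * K₁ d ^ 2 * κ₀ * Real.exp (L * (κ - 3 * κ₀ - 3)) * H₀ ≤ 1)
    {Y : Finset (TPt d N)} (hY : Y ∈ cunions Θ Pol) :
    ‖HsharpL Θ (cunions Θ Pol) (KY id Θ Pol fun T => ∏ X ∈ T, a X) Y‖ ≤
      Csharp d κ₀ * H₀ * Real.exp (-(L * (κ - 6 * κ₀ - 6)) * torusTreeLenMod Y Θ) := by
  have hκ₀ : 0 ≤ κ₀ := le_trans (by positivity) hκv
  have h := sunshineY Θ hPol hκ₁ hκv (three_kappa_le hL hκ₀ hκ) hH₀ ha hsmall hY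
  refine h.trans (mul_le_mul_of_nonneg_left (Real.exp_le_exp.2 ?_) ?_)
  · have hℓ := torusTreeLenMod_nonneg Y Θ
    have hr := rate_key (κ := κ) hL hκ₀
    nlinarith
  · have := K₁_pos d
    unfold Csharp
    positivity

/-- (key) in the printed indexing for the activities `e^{H(X)} − 1` of the interpolated gas, `‖H(X)‖ ≤ H₀e^{−L(κ−3κ₀−3)d_M(X, mod
Θ)}` = (keykey) with `c_0 = H₀ ≤ log 2`. [cite: Dimock2013BalabanII, §3.14 Lemma 3.18 eqs. (keykey), (key) (arXiv:1212.5562v2 TeX L5457–5500)] -/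
theorem sunshineY_LM_of_H (Θ : Finset (TPt d N)) {Pol : Finset (Finset (TPt d N))}
    (hPol : ∀ X ∈ Pol, X.Nonempty ∧ TFaceConnected X ∧ DMod Θ X ∧ (X \ Θ).Nonempty)
    {H : Finset (TPt d N) → ℂ} {κ κ₀ H₀ L : ℝ} (hκ₁ : kappa₁ d ≤ κ₀) (hκv : 4 * 2 ^ d ≤ κ₀) (hL : 1 ≤ L)
    (hκ : 6 * κ₀ + 6 ≤ κ) (hH₀ : 0 ≤ H₀) (hlog : H₀ ≤ Real.log 2)
    (hH : ∀ X ∈ Pol, ‖H X‖ ≤ H₀ * Real.exp (-(L * (κ - 3 * κ₀ - 3)) * torusTreeLenMod X Θ))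
    (hsmall : 2 * Real.exp 1 * K₁ d ^ 2 * κ₀ * Real.exp (L * (κ - 3 * κ₀ - 3)) * H₀ ≤ 1)
    {Y : Finset (TPt d N)} (hY : Y ∈ cunions Θ Pol) :
    ‖HsharpL Θ (cunions Θ Pol) (KY id Θ Pol fun T => ∏ X ∈ T, (Complex.exp (H X) - 1)) Y‖ ≤
      Csharp d κ₀ * H₀ * Real.exp (-(L * (κ - 6 * κ₀ - 6)) * torusTreeLenMod Y Θ) := by
  have hκ₀ : 0 ≤ κ₀ := le_trans (by positivity) hκv
  have hκ0 : 0 ≤ L * (κ - 3 * κ₀ - 3) := le_trans (by positivity) (three_kappa_le hL hκ₀ hκ)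
  exact sunshineY_LM Θ hPol hκ₁ hκv hL hκ hH₀ (weight_le_of_mem Θ hH₀ hlog hκ0 hH) hsmall hY

omit [NeZero N] in
/-- *"if Y ⊂ Λ_{k+1} then no boundary term B^{loc}_{k,π⁺}(Y) can contribute. This is a consequence of the local influence
property of the cluster expansion. Hence H^#(1,u,Y) is independent of u and so B^#_{k,π⁺}(Y) = 0"* (L5531–5533), IN THE PRINTED
INDEXING: if the `u = 1` and `u = 0` activities agree on the members `Y′ ⊆ Y` of the volume of unions `L`, then `B^#(Y) =
H^#_{u=1}(Y) − H^#_{u=0}(Y) = 0` (`ClusterExpansionByUnions.HsharpL_congr_local`).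
[cite: Dimock2013BalabanII, §3.14 Lemma 3.19 proof (arXiv:1212.5562v2 TeX L5531–5533)] -/
theorem HsharpL_sub_eq_zero_of_local {Θ : Finset (TPt d N)} {L : Finset (Finset (TPt d N))}
    {w₁ w₀ : Finset (TPt d N) → ℂ} {Y : Finset (TPt d N)} (h : ∀ Y' ∈ L, Y' ⊆ Y → w₁ Y' = w₀ Y') :
    HsharpL Θ L w₁ Y - HsharpL Θ L w₀ Y = 0 := by
  rw [HsharpL_congr_local h, sub_self]

end PrintedIndexing

/-! ## Part 7 (v1.2). (whale) for the kernel's `H^#(1,u,Y)`, the analyticity hypothesis DISCHARGED -/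

section WhaleKernel

open Literature.MathematicalPhysics.QuantumFieldTheory.Dimock2011to13.ClusterExpansionByUnions
open Literature.MathematicalPhysics.QuantumFieldTheory.Dimock2011to13.ClusterExpansionAnalytic
open Literature.Probability.LatticeModels (IsKPVolume)

variable {Q C : Type*} [DecidableEq C]

/-- THE INTERPOLATED ACTIVITIES at `t = 1`: `e^{H_{k,π⁺}(1,u,X)} − 1` with `H(1,u,X) = H(X) + u·B(X)` (`H(X)` = `(δE_k^+)^{loc}(X)
+ R^{loc}(X)1_{X⊂Λ}`, `B(X)` = `B^{loc}(X)1_{X#Λ}`). [cite: Dimock2013BalabanII, §3.14 (arXiv:1212.5562v2 TeX L5441–5452)] -/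
def aInterp (H B : Q → ℂ) (u : ℂ) (X : Q) : ℂ := Complex.exp (H X + u * B X) - 1

/-- `u ↦ H^#_{k,π⁺}(1,u,Y)` for the kernel's `H^#` (printed indexing: `ClusterExpansionByUnions.HsharpL` over a volume of
unions `L`, regrouped activities `KY`). [cite: Dimock2013BalabanII, §3.14 Lemma 3.18 eq. (output) (arXiv:1212.5562v2 TeX L5457–5466)] -/
def HsharpInterp (idx : Q → Finset C) (Θ : Finset C) (Pol : Finset Q) (L : Finset (Finset C)) (H B : Q → ℂ)
    (Y : Finset C) (u : ℂ) : ℂ :=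
  HsharpL Θ L (KY idx Θ Pol fun T => ∏ X ∈ T, aInterp H B u X) Y

/-- unfolding `HsharpInterp`. [cite: Dimock2013BalabanII, §3.14 Lemma 3.18 (arXiv:1212.5562v2 TeX L5457–5466)] -/
theorem hsharpInterp_apply (idx : Q → Finset C) (Θ : Finset C) (Pol : Finset Q) (L : Finset (Finset C))
    (H B : Q → ℂ) (Y : Finset C) (u : ℂ) :
    HsharpInterp idx Θ Pol L H B Y u =
      HsharpL Θ L (KY idx Θ Pol fun T => ∏ X ∈ T, (Complex.exp (H X + u * B X) - 1)) Y := rfl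

/-- `u ↦ H^#(1,u,Y)` IS HOLOMORPHIC on the closed disc `|u| ≤ ρ` as soon as the gas of unions is Kotecký–Preiss for every
`|u| < ρ′`, `ρ < ρ′` (the sibling's `differentiableOn_HsharpL_interp_closedBall`).
[cite: Dimock2013BalabanII, §3.14 Lemma 3.18 (arXiv:1212.5562v2 TeX L5466)] -/
theorem differentiableOn_hsharpInterp {idx : Q → Finset C} (Θ : Finset C) {Pol : Finset Q} {L : Finset (Finset C)}
    (H B : Q → ℂ) {kpa : Finset C → ℝ} {ρ ρ' : ℝ} (hρ' : ρ < ρ')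
    (hKP : ∀ u ∈ ball (0 : ℂ) ρ', IsKPVolume (IncΩ Θ) (KY idx Θ Pol fun T => ∏ X ∈ T, aInterp H B u X) kpa L)
    (Y : Finset C) : DifferentiableOn ℂ (HsharpInterp idx Θ Pol L H B Y) (closedBall (0 : ℂ) ρ) :=
  differentiableOn_HsharpL_interp_closedBall Θ H B isOpen_ball (closedBall_subset_ball hρ') hKP Y

/-- **(whale) FOR THE KERNEL's `H^#`** — [Dimock2013BalabanII] Lemma 3.19 proof (L5527–5535: *"B^#_{k,π⁺}(Y) = (1/2πi)∮ du/(u(u−1))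
H^#(1,u,Y) … The bound (key) on H^#(1,u,Y) for |u| = r_0L^{−3}λ_k^{−1/4+10ε} now implies that B^# satisfies (whale)"*), with
the analyticity of `u ↦ H^#(1,u,Y)` no longer a hypothesis: if `2 ≤ ρ < ρ′`, the gas of unions is Kotecký–Preiss for every
`|u| < ρ′`, and `‖H^#(1,u,Y)‖ ≤ M` on `|u| = ρ`, then `‖B^#(Y)‖ = ‖H^#(1,1,Y) − H^#(1,0,Y)‖ ≤ 2M/ρ`.
[cite: Dimock2013BalabanII, §3.14 Lemma 3.19 eq. (whale) with proof (arXiv:1212.5562v2 TeX L5507–5535)] -/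
theorem whale_kernel {idx : Q → Finset C} (Θ : Finset C) {Pol : Finset Q} {L : Finset (Finset C)} (H B : Q → ℂ)
    {kpa : Finset C → ℝ} {ρ ρ' M : ℝ} (hρ : 2 ≤ ρ) (hρ' : ρ < ρ')
    (hKP : ∀ u ∈ ball (0 : ℂ) ρ', IsKPVolume (IncΩ Θ) (KY idx Θ Pol fun T => ∏ X ∈ T, aInterp H B u X) kpa L)
    (Y : Finset C) (hM : ∀ u ∈ sphere (0 : ℂ) ρ, ‖HsharpInterp idx Θ Pol L H B Y u‖ ≤ M) :
    ‖HsharpInterp idx Θ Pol L H B Y 1 - HsharpInterp idx Θ Pol L H B Y 0‖ ≤ 2 * M / ρ :=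
  norm_sub_le_two_mul_div hρ (differentiableOn_hsharpInterp Θ H B hρ' hKP Y) hM

/-- **(whale) ∕ (whale2) AT THE PRINTED RADIUS** `ρ = r₀/(L³λ^p)` for the kernel's `H^#`: `‖H^#(1,1,Y) − H^#(1,0,Y)‖ ≤
(2/r₀)·L³·λ^p·M` — analyticity discharged, the KP condition on a slightly larger disc and the (key) bound `M` on the circle
as inputs. [cite: Dimock2013BalabanII, §3.14 Lemma 3.19 eq. (whale), Lemma 3.20 eq. (whale2) (arXiv:1212.5562v2 TeX L5507–5572)] -/
theorem whale_kernel_radius {idx : Q → Finset C} (Θ : Finset C) {Pol : Finset Q} {L : Finset (Finset C)}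
    (H B : Q → ℂ) {kpa : Finset C → ℝ} {r₀ Lr lam p ρ' M : ℝ} (hr₀ : 0 < r₀) (hL : 0 < Lr) (hlam : 0 < lam)
    (hρ : 2 ≤ r₀ / (Lr ^ 3 * lam ^ p)) (hρ' : r₀ / (Lr ^ 3 * lam ^ p) < ρ')
    (hKP : ∀ u ∈ ball (0 : ℂ) ρ', IsKPVolume (IncΩ Θ) (KY idx Θ Pol fun T => ∏ X ∈ T, aInterp H B u X) kpa L)
    (Y : Finset C)
    (hM : ∀ u ∈ sphere (0 : ℂ) (r₀ / (Lr ^ 3 * lam ^ p)), ‖HsharpInterp idx Θ Pol L H B Y u‖ ≤ M) :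
    ‖HsharpInterp idx Θ Pol L H B Y 1 - HsharpInterp idx Θ Pol L H B Y 0‖ ≤ 2 / r₀ * Lr ^ 3 * lam ^ p * M := by
  rw [← two_mul_div_radius hr₀ hL hlam]
  exact whale_kernel Θ H B hρ hρ' hKP Y hM

/-- THE CONTOUR FORMULA OF LEMMA 3.19 FOR THE KERNEL's `H^#`, analyticity discharged: `B^#(Y) = (1/2πi)∮_{|u|=ρ}
du/(u(u−1)) H^#(1,u,Y)` for `1 < ρ < ρ′` with the gas Kotecký–Preiss on `|u| < ρ′`.
[cite: Dimock2013BalabanII, §3.14 Lemma 3.19 proof (arXiv:1212.5562v2 TeX L5527–5530)] -/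
theorem sub_eq_contour_kernel {idx : Q → Finset C} (Θ : Finset C) {Pol : Finset Q} {L : Finset (Finset C)}
    (H B : Q → ℂ) {kpa : Finset C → ℝ} {ρ ρ' : ℝ} (hρ : 1 < ρ) (hρ' : ρ < ρ')
    (hKP : ∀ u ∈ ball (0 : ℂ) ρ', IsKPVolume (IncΩ Θ) (KY idx Θ Pol fun T => ∏ X ∈ T, aInterp H B u X) kpa L)
    (Y : Finset C) :
    HsharpInterp idx Θ Pol L H B Y 1 - HsharpInterp idx Θ Pol L H B Y 0 =
      (2 * Real.pi * Complex.I : ℂ)⁻¹ •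
        ∮ u in C(0, ρ), (u * (u - 1))⁻¹ • HsharpInterp idx Θ Pol L H B Y u :=
  sub_eq_contour hρ (differentiableOn_hsharpInterp Θ H B hρ' hKP Y)

end WhaleKernel

/-! ## Part 8 (v1.3). (whale) for the kernel's `H^#` from (keykey) on the disc (torus carrier) -/

section WhaleTorus

open Literature.MathematicalPhysics.QuantumFieldTheory.Dimock2011to13.ClusterExpansionByUnions
open Literature.MathematicalPhysics.QuantumFieldTheory.Dimock2011to13.ClusterExpansionAnalytic
open Literature.Probability.LatticeModels (IsKPVolume)

variable {d N : ℕ} [NeZero N]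

/-- **(keykey) AT ONE `u` ⟹ THE INTERPOLATED GAS OF UNIONS IS A KOTECKÝ–PREISS VOLUME** (*"This is the input for the
cluster expansion"*, L5498): if `‖H(X) + u·B(X)‖ ≤ c₀e^{−κ′d_M(X, mod Θ)}` on `Pol` with `0 ≤ c₀ ≤ log 2`, `max(κ₁(d), 4·2^d) ≤
κ₀`, `3κ₀ + 3 ≤ κ′` and `2e·K₁(d)²·κ₀·e^{κ′}·c₀ ≤ 1`, then the gas of Ω-connected unions with activities `K(Y) = Σ Π
(e^{H+uB} − 1)` is a KP volume (size `θ|Y ∩ Ω|`) — `weight_le_of_mem`, `norm_KY_le_of_mem_cunions`, `isKPVolumeY`.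
[cite: Dimock2013BalabanII, §3.14 Lemma 3.18 proof (arXiv:1212.5562v2 TeX L5478–5500); App. F Theorem cluster3 proof (L7063–7077)] -/
theorem kp_of_keykey (Θ : Finset (TPt d N)) {Pol : Finset (Finset (TPt d N))}
    (hPol : ∀ X ∈ Pol, X.Nonempty ∧ TFaceConnected X ∧ DMod Θ X ∧ (X \ Θ).Nonempty)
    {H B : Finset (TPt d N) → ℂ} {κ' κ₀ c₀ : ℝ} (hκ₁ : kappa₁ d ≤ κ₀) (hκv : 4 * 2 ^ d ≤ κ₀)
    (hκ' : 3 * κ₀ + 3 ≤ κ') (hc₀ : 0 ≤ c₀) (hlog : c₀ ≤ Real.log 2)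
    (hsmall : 2 * Real.exp 1 * K₁ d ^ 2 * κ₀ * Real.exp κ' * c₀ ≤ 1) {u : ℂ}
    (hkk : ∀ X ∈ Pol, ‖H X + u * B X‖ ≤ c₀ * Real.exp (-κ' * torusTreeLenMod X Θ)) :
    IsKPVolume (IncΩ Θ) (KY id Θ Pol fun T => ∏ X ∈ T, aInterp H B u X) (kpSizeΩ (theta d κ' κ₀ c₀) Θ)
      (cunions Θ Pol) := by
  have hκ₀ : 0 ≤ κ₀ := le_trans (by positivity) hκv
  have hκ0 : 0 ≤ κ' := by linarith
  have hκle : κ₀ ≤ κ' := by linarith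
  have hδ : 0 ≤ delta d κ' κ₀ := by unfold delta; linarith
  obtain ⟨hsmall₁, hθ⟩ := smallness_of_single (d := d) hκ₀ hc₀ hsmall
  have ha := weight_le_of_mem Θ (H := fun X => H X + u * B X) hc₀ hlog hκ0 hkk
  exact isKPVolumeY Θ hPol hκv hδ hc₀ (norm_KY_le_of_mem_cunions Θ hPol hκ₁ hκv hκle hc₀ ha hsmall₁) hθ

/-- **(whale) FOR THE KERNEL's `H^#` FROM (keykey) ON THE DISC** — [Dimock2013BalabanII] Lemma 3.19, verbatim (L5514–5516):
*"|B^#_{k,π⁺}(Y)| ≤ 𝒪(1) L³ λ^{1/4−10ε} e^{−L(κ−6κ_0−6)d_{LM}(Y, mod Ω^c_{k+1})}"* — here: from (keykey) `‖H(X) + u·B(X)‖ ≤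
c₀e^{−L(κ−3κ₀−3)d_M(X, mod Θ)}` for ALL `|u| ≤ ρ′` (the module's Part 1 at each `u`), the F.1 regime, and `2 ≤ ρ < ρ′`:
`‖H^#(1,1,Y) − H^#(1,0,Y)‖ ≤ (2/ρ)·C♯(d,κ₀)·c₀·e^{−L(κ−6κ₀−6)·d_M(Y, mod Θ)}` for every Ω-connected union `Y` — analyticity
(`ClusterExpansionAnalytic`), (output)∕(key) (`sunshineY_LM_of_H`) and the KP condition (`kp_of_keykey`) all DISCHARGED; at
`ρ = r₀/(L³λ^{1/4−10ε})` the factor `2/ρ` is the printed `𝒪(1)L³λ^{1/4−10ε}` (`two_mul_div_radius`).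
[cite: Dimock2013BalabanII, §3.14 Lemma 3.19 eq. (whale) with proof (arXiv:1212.5562v2 TeX L5507–5535)] -/
theorem whale_from_keykey (Θ : Finset (TPt d N)) {Pol : Finset (Finset (TPt d N))}
    (hPol : ∀ X ∈ Pol, X.Nonempty ∧ TFaceConnected X ∧ DMod Θ X ∧ (X \ Θ).Nonempty)
    (H B : Finset (TPt d N) → ℂ) {κ κ₀ c₀ Lr ρ ρ' : ℝ} (hκ₁ : kappa₁ d ≤ κ₀) (hκv : 4 * 2 ^ d ≤ κ₀)
    (hL : 1 ≤ Lr) (hκ : 6 * κ₀ + 6 ≤ κ) (hc₀ : 0 ≤ c₀) (hlog : c₀ ≤ Real.log 2)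
    (hsmall : 2 * Real.exp 1 * K₁ d ^ 2 * κ₀ * Real.exp (Lr * (κ - 3 * κ₀ - 3)) * c₀ ≤ 1)
    (hρ : 2 ≤ ρ) (hρ' : ρ < ρ')
    (hkk : ∀ u ∈ closedBall (0 : ℂ) ρ', ∀ X ∈ Pol,
      ‖H X + u * B X‖ ≤ c₀ * Real.exp (-(Lr * (κ - 3 * κ₀ - 3)) * torusTreeLenMod X Θ))
    {Y : Finset (TPt d N)} (hY : Y ∈ cunions Θ Pol) :
    ‖HsharpInterp id Θ Pol (cunions Θ Pol) H B Y 1 - HsharpInterp id Θ Pol (cunions Θ Pol) H B Y 0‖ ≤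
      2 * (Csharp d κ₀ * c₀ * Real.exp (-(Lr * (κ - 6 * κ₀ - 6)) * torusTreeLenMod Y Θ)) / ρ := by
  have hκ₀ : 0 ≤ κ₀ := le_trans (by positivity) hκv
  have hκ' : 3 * κ₀ + 3 ≤ Lr * (κ - 3 * κ₀ - 3) := three_kappa_le hL hκ₀ hκ
  refine whale_kernel (kpa := kpSizeΩ (theta d (Lr * (κ - 3 * κ₀ - 3)) κ₀ c₀) Θ) Θ H B hρ hρ'
    (fun u hu => kp_of_keykey Θ hPol hκ₁ hκv hκ' hc₀ hlog hsmall (hkk u (ball_subset_closedBall hu))) Y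
    fun u hu => ?_
  exact sunshineY_LM_of_H Θ hPol hκ₁ hκv hL hκ hc₀ hlog
    (hkk u (closedBall_subset_closedBall hρ'.le (sphere_subset_closedBall hu))) hsmall hY


/-! ## Part 9 (v1.4). The hole-free case: LEMMA 3.20's setting (*"standard cluster expansion with no holes"*) -/

/-- **(whale2)'s SETTING — THE HOLE-FREE CASE OF `whale_from_keykey`** — [Dimock2013BalabanII] Lemma 3.20, proof, verbatim
(L5554–5558): *"Now we are back to the standard cluster expansion with no holes and all polymers contained in Λ_{k+1}.
H_{k,π⁺}(t,0,Y) is analytic in |t| ≤ r_0L^{−3}λ_k^{−n_0} with the bound |H_{k,π⁺}(t,0,Y)| ≤ c_0 e^{−L(κ−3κ_0−3)d_{LM}(Y)}.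
Therefore H^#_{k,π⁺}(t,0,Y) is analytic in the same domain with bound |H^#_{k,π⁺}(t,0,Y)| ≤ 𝒪(1) e^{−L(κ−6κ_0−6)d_{LM}(Y)}
(key4)"* and (L5571–5572) *"The bound (key4) now implies that R^#_{k,π⁺}(Y) satisfies (whale2)"* — here: `Θ = ∅`, non-empty
face-connected polymers, (keykey)-type input `‖H(X) + u·B(X)‖ ≤ c₀e^{−L(κ−3κ₀−3)d_M(X)}` for `|u| ≤ ρ′`, the F.1 regime and `2 ≤
ρ < ρ′` ⟹ `‖H^#(1,1,Y) − H^#(1,0,Y)‖ ≤ (2/ρ)·C♯(d,κ₀)·c₀·e^{−L(κ−6κ₀−6)·d_M(Y)}` with part I's tree length `d_M(Y)`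
(`pol_of_noHoles`, `torusTreeLenMod_empty`); read with `(H, B, u) := ((δE_k^+)^{loc}, R^{loc}, t)` this is (whale2)'s shape.
[cite: Dimock2013BalabanII, §3.14 Lemma 3.20 eq. (whale2) with proof (arXiv:1212.5562v2 TeX L5539–5572)] -/
theorem whale_from_keykey_noHoles {Pol : Finset (Finset (TPt d N))}
    (hPol : ∀ X ∈ Pol, X.Nonempty ∧ TFaceConnected X)
    (H B : Finset (TPt d N) → ℂ) {κ κ₀ c₀ Lr ρ ρ' : ℝ} (hκ₁ : kappa₁ d ≤ κ₀) (hκv : 4 * 2 ^ d ≤ κ₀)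
    (hL : 1 ≤ Lr) (hκ : 6 * κ₀ + 6 ≤ κ) (hc₀ : 0 ≤ c₀) (hlog : c₀ ≤ Real.log 2)
    (hsmall : 2 * Real.exp 1 * K₁ d ^ 2 * κ₀ * Real.exp (Lr * (κ - 3 * κ₀ - 3)) * c₀ ≤ 1)
    (hρ : 2 ≤ ρ) (hρ' : ρ < ρ')
    (hkk : ∀ u ∈ closedBall (0 : ℂ) ρ', ∀ X ∈ Pol,
      ‖H X + u * B X‖ ≤ c₀ * Real.exp (-(Lr * (κ - 3 * κ₀ - 3)) * torusTreeLen X))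
    {Y : Finset (TPt d N)} (hY : Y ∈ cunions ∅ Pol) :
    ‖HsharpInterp id ∅ Pol (cunions ∅ Pol) H B Y 1 - HsharpInterp id ∅ Pol (cunions ∅ Pol) H B Y 0‖ ≤
      2 * (Csharp d κ₀ * c₀ * Real.exp (-(Lr * (κ - 6 * κ₀ - 6)) * torusTreeLen Y)) / ρ := by
  have hkk' : ∀ u ∈ closedBall (0 : ℂ) ρ', ∀ X ∈ Pol,
      ‖H X + u * B X‖ ≤ c₀ * Real.exp (-(Lr * (κ - 3 * κ₀ - 3)) * torusTreeLenMod X ∅) := fun u hu X hX => by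
    rw [torusTreeLenMod_empty]; exact hkk u hu X hX
  have h := whale_from_keykey ∅ (pol_of_noHoles hPol) H B hκ₁ hκv hL hκ hc₀ hlog hsmall hρ hρ' hkk' hY
  rwa [torusTreeLenMod_empty] at h


/-! ## Part 10 (v1.5). (whale)∕(whale2) AS PRINTED: the radius `ρ = r₀/(L³λ^p)` and the constant `𝒪(1) = (2/r₀)·C♯(d,κ₀)·c₀` -/

/-- **(whale) AS PRINTED, FOR THE KERNEL's `H^#`, CONSTANTS IDENTIFIED** — [Dimock2013BalabanII] Lemma 3.19, verbatim
(L5514–5516, L5534–5535): *"|B^#_{k,π⁺}(Y)| ≤ 𝒪(1) L³ λ^{1/4−10ε} e^{−L(κ−6κ_0−6)d_{LM}(Y, mod Ω^c_{k+1})}  (whale) … The bound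
(key) on H^#_{k,π⁺}(1,u,Y) for |u| = r_0L^{−3}λ_k^{−1/4+10ε} now implies that B^#_{k,π⁺}(Y) satisfies (whale)"* — here:
`whale_from_keykey` at the printed radius `ρ = r₀/(L³λ^p)` (any real `p`; the print's `p = ¼ − 10ε`), (keykey) on a disc
`|u| ≤ ρ′` with `ρ < ρ′`, and `2 ≤ ρ` (the print's *"r_0 = 𝒪(1) sufficiently small … λ_k sufficiently small"*):
`‖H^#(1,1,Y) − H^#(1,0,Y)‖ ≤ (2/r₀)·L³·λ^p·C♯(d,κ₀)·c₀·e^{−L(κ−6κ₀−6)·d_M(Y, mod Θ)}` — the print's `𝒪(1)` is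
`(2/r₀)·C♯(d,κ₀)·c₀` (`two_mul_div_radius`). [cite: Dimock2013BalabanII, §3.14 Lemma 3.19 eq. (whale) with proof (arXiv:1212.5562v2 TeX L5507–5535)] -/
theorem whale_printed (Θ : Finset (TPt d N)) {Pol : Finset (Finset (TPt d N))}
    (hPol : ∀ X ∈ Pol, X.Nonempty ∧ TFaceConnected X ∧ DMod Θ X ∧ (X \ Θ).Nonempty)
    (H B : Finset (TPt d N) → ℂ) {κ κ₀ c₀ Lr r₀ lam p ρ' : ℝ} (hκ₁ : kappa₁ d ≤ κ₀) (hκv : 4 * 2 ^ d ≤ κ₀)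
    (hL : 1 ≤ Lr) (hκ : 6 * κ₀ + 6 ≤ κ) (hc₀ : 0 ≤ c₀) (hlog : c₀ ≤ Real.log 2)
    (hsmall : 2 * Real.exp 1 * K₁ d ^ 2 * κ₀ * Real.exp (Lr * (κ - 3 * κ₀ - 3)) * c₀ ≤ 1)
    (hr₀ : 0 < r₀) (hlam : 0 < lam) (hρ : 2 ≤ r₀ / (Lr ^ 3 * lam ^ p)) (hρ' : r₀ / (Lr ^ 3 * lam ^ p) < ρ')
    (hkk : ∀ u ∈ closedBall (0 : ℂ) ρ', ∀ X ∈ Pol,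
      ‖H X + u * B X‖ ≤ c₀ * Real.exp (-(Lr * (κ - 3 * κ₀ - 3)) * torusTreeLenMod X Θ))
    {Y : Finset (TPt d N)} (hY : Y ∈ cunions Θ Pol) :
    ‖HsharpInterp id Θ Pol (cunions Θ Pol) H B Y 1 - HsharpInterp id Θ Pol (cunions Θ Pol) H B Y 0‖ ≤
      2 / r₀ * Lr ^ 3 * lam ^ p *
        (Csharp d κ₀ * c₀ * Real.exp (-(Lr * (κ - 6 * κ₀ - 6)) * torusTreeLenMod Y Θ)) := by
  rw [← two_mul_div_radius hr₀ (lt_of_lt_of_le one_pos hL) hlam]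
  exact whale_from_keykey Θ hPol H B hκ₁ hκv hL hκ hc₀ hlog hsmall hρ hρ' hkk hY

/-- **(whale2) AS PRINTED, FOR THE KERNEL's `H^#`, hole-free** — [Dimock2013BalabanII] Lemma 3.20, verbatim (L5547–5550,
L5571–5572): *"|R^#_{k,π⁺}(Y)| ≤ 𝒪(1)L³ λ_k^{n_0} e^{−L(κ−6κ_0−6)d_{LM}(Y)}  (whale2) … The bound (key4) now implies that
R^#_{k,π⁺}(Y) satisfies (whale2)"* — `whale_from_keykey_noHoles` at the printed radius `ρ = r₀/(L³λ^p)` (the print's `p =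
n₀`), read with `(H, B, u) := ((δE_k^+)^{loc}, R^{loc}, t)`: `‖H^#(1,1,Y) − H^#(1,0,Y)‖ ≤ (2/r₀)·L³·λ^p·C♯(d,κ₀)·c₀·
e^{−L(κ−6κ₀−6)·d_M(Y)}`. [cite: Dimock2013BalabanII, §3.14 Lemma 3.20 eq. (whale2) with proof (arXiv:1212.5562v2 TeX L5539–5572)] -/
theorem whale_printed_noHoles {Pol : Finset (Finset (TPt d N))}
    (hPol : ∀ X ∈ Pol, X.Nonempty ∧ TFaceConnected X)
    (H B : Finset (TPt d N) → ℂ) {κ κ₀ c₀ Lr r₀ lam p ρ' : ℝ} (hκ₁ : kappa₁ d ≤ κ₀) (hκv : 4 * 2 ^ d ≤ κ₀)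
    (hL : 1 ≤ Lr) (hκ : 6 * κ₀ + 6 ≤ κ) (hc₀ : 0 ≤ c₀) (hlog : c₀ ≤ Real.log 2)
    (hsmall : 2 * Real.exp 1 * K₁ d ^ 2 * κ₀ * Real.exp (Lr * (κ - 3 * κ₀ - 3)) * c₀ ≤ 1)
    (hr₀ : 0 < r₀) (hlam : 0 < lam) (hρ : 2 ≤ r₀ / (Lr ^ 3 * lam ^ p)) (hρ' : r₀ / (Lr ^ 3 * lam ^ p) < ρ')
    (hkk : ∀ u ∈ closedBall (0 : ℂ) ρ', ∀ X ∈ Pol,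
      ‖H X + u * B X‖ ≤ c₀ * Real.exp (-(Lr * (κ - 3 * κ₀ - 3)) * torusTreeLen X))
    {Y : Finset (TPt d N)} (hY : Y ∈ cunions ∅ Pol) :
    ‖HsharpInterp id ∅ Pol (cunions ∅ Pol) H B Y 1 - HsharpInterp id ∅ Pol (cunions ∅ Pol) H B Y 0‖ ≤
      2 / r₀ * Lr ^ 3 * lam ^ p * (Csharp d κ₀ * c₀ * Real.exp (-(Lr * (κ - 6 * κ₀ - 6)) * torusTreeLen Y)) := by
  rw [← two_mul_div_radius hr₀ (lt_of_lt_of_le one_pos hL) hlam]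
  exact whale_from_keykey_noHoles hPol H B hκ₁ hκv hL hκ hc₀ hlog hsmall hρ hρ' hkk hY

end WhaleTorus

/-! ## Non-vacuity -/

/-- The radius regime of Part 3 is inhabited: e.g. `r₀ = 1`, `L = 1`, `λ = 1/4`, `p = 1` gives `ρ = 4 ≥ 2`. [folklore] -/
example : (2 : ℝ) ≤ 1 / ((1 : ℝ) ^ 3 * (1 / 4 : ℝ) ^ (1 : ℝ)) := by
  rw [Real.rpow_one]
  norm_num

/-- The interpolation `Hinterp` at `t = u = 1` with both indicators on is the full sum `E + R + B` (sanity check of the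
bookkeeping). [folklore] -/
example (E R B : ℂ) : Hinterp E R B True True 1 1 = E + R + B := by
  simp [Hinterp]

end Literature.MathematicalPhysics.QuantumFieldTheory.Dimock2011to13.InterpolationRemoval

end
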